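import Literature.MathematicalPhysics.QuantumLattice.LatticeGaugeDLRFreeEnergyProofs
import Literature.MathematicalPhysics.QuantumFieldTheory.LatticeRPCauchySchwarz
import Literature.MathematicalPhysics.QuantumFieldTheory.ChatterjeeScaleComparison
import Literature.MathematicalPhysics.QuantumFieldTheory.ConstructiveQFTWave0Proofs
import Literature.RepresentationTheory.CompactGroups.UnitaryTrick
import HarnessLib

/-!
# Site-hyperplane reflection positivity for Wilson's lattice gauge theory, file 1∕4: reflections of the torus `(ℤ/L)^d`, of its links and
# gauge configurations (reflect sites, INVERT the direction-`i` links), heights, positive∕in-plane links, measure preservation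

Landed for item `stmt-QuantumFields-19354` (`--supports … --as helper`) by the LEAD prover ab-p1 under director-ym RULING g9-№2 ∕ №14 (3)
(critic ym-ir-crit-2 03:04:13Z ∕ 03:14:37Z: PASS as supplier); authored by ideator ym-ir-idea-5 g7, split of the sorry-free workfile
`Cruxes/IR/Lines/pressure_monotone_tm.lean` v5 (Part B = `Cruxes/IR/Lines/rp_doubling.lean`) per `Cruxes/IR/Lines/pressure_monotone_tm_LANDING.md`
(eight files: `SiteRPGeometry` → `SiteRPDoubling` → `SiteRPZdBoxes` → `SiteRPFreeCubeDoubling`; `PressureMonotoneTMFloor` → `…LinearFloor` → `…LogFloor` → `…Equipartition`).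

Content (§1–§2 of Part B): `siteReflect`, `edgeReflect[Equiv]`, `configReflect`, `plaqReflect`, `plaquetteHolonomy_configReflect_*`, `plaquetteCost_configReflect`;
`ht`, `posEdges`, `planeEdges`, `edgeReflect_not_mem_posEdges`, `dependsOn_configReflect`, `measurePreserving_configReflect`.
Glimm–Jaffe §10.5 multiple reflections, transplanted to the product Haar measure (Fröhlich–Israel–Lieb–Simon CMP 62 (1978) §4; Osterwalder–Seiler 1978 §3).

HONESTY.  Supplier ∕ kinematic content only (holds for `U(1)` too): nothing here proves the Yang–Mills mass gap (Clay), `BalabanLadder.IR`,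
`BalabanLadder.NT` or a lattice gap; R4 closes only the conditional finite-𝕋⁴ rung `BalabanLadder.UV`.
-/

open MeasureTheory Finset Filter
open scoped ComplexConjugate

namespace Summit.QuantumFields.YangMills.Cruxes.IR.RPDoubling

open Literature.MathematicalPhysics.QuantumFieldTheory
open Literature.MathematicalPhysics.QuantumLattice

noncomputable section

/-! ## §1 Site reflections of the discrete torus and of its gauge configurations -/

section TorusGeometry

variable {d L : ℕ}

/-- The reflection of the torus `(ℤ/L)^d` in the lattice hyperplane `x_i = c`. -/
def siteReflect (i : Fin d) (c : ZMod L) (x : Site d L) : Site d L :=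
  Function.update x i (c + c - x i)

/-- The reflected coordinate: `(siteReflect i c x) i = 2c − x i`. -/
@[simp] theorem siteReflect_apply_self (i : Fin d) (c : ZMod L) (x : Site d L) :
    siteReflect i c x i = c + c - x i := by
  simp [siteReflect]

/-- `siteReflect i c` does not move the coordinates `k ≠ i`. -/
@[simp] theorem siteReflect_apply_ne (i : Fin d) (c : ZMod L) (x : Site d L) {k : Fin d} (h : k ≠ i) :
    siteReflect i c x k = x k := by
  simp [siteReflect, h]

/-- `siteReflect i c` is an involution. -/
@[simp] theorem siteReflect_siteReflect (i : Fin d) (c : ZMod L) (x : Site d L) :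
    siteReflect i c (siteReflect i c x) = x := by
  ext k
  by_cases h : k = i
  · subst h; simp
  · simp [h]

/-- `siteReflect i c` commutes with the unit shift in a direction `k ≠ i`. -/
theorem siteReflect_shift_ne (i : Fin d) (c : ZMod L) (x : Site d L) {k : Fin d} (h : k ≠ i) :
    siteReflect i c (x.shift k) = (siteReflect i c x).shift k := by
  ext l
  by_cases hl : l = i
  · subst hl
    simp [Site.shift, Ne.symm h]
  · simp [Site.shift, hl]

/-- Reflecting the `i`-shifted site: `siteReflect i c (x.shift i) = siteReflect i c x − e_i`. -/
theorem siteReflect_shift_self (i : Fin d) (c : ZMod L) (x : Site d L) :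
    siteReflect i c (x.shift i) = siteReflect i c x - Pi.single i 1 := by
  ext l
  by_cases hl : l = i
  · subst hl
    simp [Site.shift]; abel
  · simp [Site.shift, hl]

/-- `siteReflect i c (x − e_i) = siteReflect i c x + e_i`. -/
theorem siteReflect_sub_single (i : Fin d) (c : ZMod L) (x : Site d L) :
    siteReflect i c (x - Pi.single i 1) = siteReflect i c x + Pi.single i 1 := by
  ext l
  by_cases hl : l = i
  · subst hl
    simp; abel
  · simp [hl]

/-- `(θx - eᵢ).shift i = θ x`. -/
theorem sub_single_shift (i : Fin d) (y : Site d L) : (y - Pi.single i 1).shift i = y := by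
  simp [Site.shift]

/-- `(y − e_i).shift k = y.shift k − e_i` for `k ≠ i`. -/
theorem sub_single_shift_ne (i : Fin d) (y : Site d L) {k : Fin d} (_h : k ≠ i) :
    (y - Pi.single i 1).shift k = y.shift k - Pi.single i 1 := by
  simp [Site.shift]; abel

/-- The reflection on positively oriented links: a link in a direction `j ≠ i` goes to the link at the
reflected site; the link `x → x + eᵢ` goes to the link `θx - eᵢ → θx` (traversed backwards). -/
def edgeReflect (i : Fin d) (c : ZMod L) (e : Edge d L) : Edge d L :=
  if e.2 = i then (siteReflect i c e.1 - Pi.single i 1, i) else (siteReflect i c e.1, e.2)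

/-- `edgeReflect i c` is an involution on links. -/
theorem edgeReflect_edgeReflect (i : Fin d) (c : ZMod L) (e : Edge d L) :
    edgeReflect i c (edgeReflect i c e) = e := by
  obtain ⟨x, j⟩ := e
  unfold edgeReflect
  by_cases h : j = i
  · subst h
    simp [siteReflect_sub_single]
  · simp [h]

/-- `edgeReflect` as a permutation of the links. -/
def edgeReflectEquiv (i : Fin d) (c : ZMod L) : Equiv.Perm (Edge d L) :=
  Function.Involutive.toPerm (edgeReflect i c) (edgeReflect_edgeReflect i c)

variable {G : Type*} [Group G]

/-- The reflection `Θ` on gauge configurations: relabel the links by `edgeReflect` and invert the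
links in direction `i` (they are traversed backwards by the reflected plaquettes). -/
def configReflect (i : Fin d) (c : ZMod L) (U : GaugeConfig d L G) : GaugeConfig d L G :=
  fun e => if e.2 = i then (U (edgeReflect i c e))⁻¹ else U (edgeReflect i c e)

/-- The reflected configuration on a link of direction `j ≠ i`: the value at the reflected link. -/
theorem configReflect_apply_ne (i : Fin d) (c : ZMod L) (U : GaugeConfig d L G) (x : Site d L)
    {j : Fin d} (h : j ≠ i) : configReflect i c U (x, j) = U (siteReflect i c x, j) := by
  simp [configReflect, edgeReflect, h]

/-- The reflected configuration on a direction-`i` link: the INVERSE of the value at the reflected (and shifted) link. -/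
theorem configReflect_apply_self (i : Fin d) (c : ZMod L) (U : GaugeConfig d L G) (x : Site d L) :
    configReflect i c U (x, i) = (U (siteReflect i c x - Pi.single i 1, i))⁻¹ := by
  simp [configReflect, edgeReflect]

/-- The reflection on plaquettes: a plaquette in a plane not containing `eᵢ` goes to the plaquette at
the reflected base point; a plaquette in a plane containing `eᵢ` goes to the one based at `θx - eᵢ`. -/
def plaqReflect (i : Fin d) (c : ZMod L) (p : Plaquette d L) : Plaquette d L :=
  (if p.2.1.1 = i ∨ p.2.1.2 = i then siteReflect i c p.1 - Pi.single i 1 else siteReflect i c p.1, p.2)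

/-- `plaqReflect i c` is an involution on plaquettes. -/
theorem plaqReflect_plaqReflect (i : Fin d) (c : ZMod L) (p : Plaquette d L) :
    plaqReflect i c (plaqReflect i c p) = p := by
  obtain ⟨x, jk⟩ := p
  unfold plaqReflect
  by_cases h : jk.1.1 = i ∨ jk.1.2 = i
  · simp [h, siteReflect_sub_single]
  · simp [h]

/-- `plaqReflect i c` is injective. -/
theorem plaqReflect_injective (i : Fin d) (c : ZMod L) : Function.Injective (plaqReflect i c) :=
  (Function.Involutive.injective (plaqReflect_plaqReflect i c))

/-- Holonomy of a reflected configuration around a plaquette in a plane NOT containing `eᵢ`. -/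
theorem plaquetteHolonomy_configReflect_of_ne (i : Fin d) (c : ZMod L) (U : GaugeConfig d L G)
    (x : Site d L) {j k : Fin d} (hj : j ≠ i) (hk : k ≠ i) :
    plaquetteHolonomy (configReflect i c U) x j k = plaquetteHolonomy U (siteReflect i c x) j k := by
  simp only [plaquetteHolonomy, configReflect_apply_ne _ _ _ _ hj, configReflect_apply_ne _ _ _ _ hk,
    siteReflect_shift_ne _ _ _ hj, siteReflect_shift_ne _ _ _ hk]

/-- Holonomy of a reflected configuration around a plaquette `(x; i, k)`: the conjugate of the INVERSE
holonomy around the reflected plaquette. -/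
theorem plaquetteHolonomy_configReflect_left (i : Fin d) (c : ZMod L) (U : GaugeConfig d L G)
    (x : Site d L) {k : Fin d} (hk : k ≠ i) :
    plaquetteHolonomy (configReflect i c U) x i k =
      (U (siteReflect i c x - Pi.single i 1, i))⁻¹ *
        (plaquetteHolonomy U (siteReflect i c x - Pi.single i 1) i k)⁻¹ *
        U (siteReflect i c x - Pi.single i 1, i) := by
  simp only [plaquetteHolonomy, configReflect_apply_ne _ _ _ _ hk, configReflect_apply_self,
    siteReflect_shift_ne _ _ _ hk, siteReflect_shift_self, sub_single_shift, sub_single_shift_ne _ _ hk]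
  group

/-- Holonomy of a reflected configuration around a plaquette `(x; j, i)`. -/
theorem plaquetteHolonomy_configReflect_right (i : Fin d) (c : ZMod L) (U : GaugeConfig d L G)
    (x : Site d L) {j : Fin d} (hj : j ≠ i) :
    plaquetteHolonomy (configReflect i c U) x j i =
      (U (siteReflect i c x - Pi.single i 1, i))⁻¹ *
        (plaquetteHolonomy U (siteReflect i c x - Pi.single i 1) j i)⁻¹ *
        U (siteReflect i c x - Pi.single i 1, i) := by
  simp only [plaquetteHolonomy, configReflect_apply_ne _ _ _ _ hj, configReflect_apply_self,
    siteReflect_shift_ne _ _ _ hj, siteReflect_shift_self, sub_single_shift, sub_single_shift_ne _ _ hj]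
  group

variable {N : ℕ} [TopologicalSpace G] [IsTopologicalGroup G] [CompactSpace G]
variable (ρ : G →* Matrix (Fin N) (Fin N) ℂ)

/-- `Re tr ρ(a⁻¹ g⁻¹ a) = Re tr ρ(g)` for a continuous representation of a compact group. -/
theorem re_trace_conj_inv (hρ : Continuous ρ) (a g : G) :
    ((ρ (a⁻¹ * g⁻¹ * a)).trace).re = ((ρ g).trace).re := by
  have h := Literature.RepresentationTheory.CompactGroups.CompactGroup.trace_conj_eq ρ g⁻¹ a⁻¹
  rw [inv_inv] at h
  rw [h, Literature.RepresentationTheory.CompactGroups.CompactGroup.re_trace_map_inv ρ hρ]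

/-- **Transport of the plaquette cost under the reflection**: `S_p(ΘU) = S_{θp}(U)` (characters of
compact groups are real on inverses and class functions). -/
theorem plaquetteCost_configReflect [NeZero L] (hρ : Continuous ρ) (i : Fin d) (c : ZMod L)
    (U : GaugeConfig d L G) (p : Plaquette d L) :
    plaquetteCost ρ (configReflect i c U) p = plaquetteCost ρ U (plaqReflect i c p) := by
  obtain ⟨x, ⟨⟨j, k⟩, hjk⟩⟩ := p
  unfold plaquetteCost plaqReflect
  simp only
  by_cases hj : j = i
  · subst hj
    have hk : k ≠ j := fun h => by simp [h] at hjk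
    rw [if_pos (Or.inl rfl), plaquetteHolonomy_configReflect_left _ _ _ _ hk, re_trace_conj_inv ρ hρ]
  · by_cases hk : k = i
    · subst hk
      rw [if_pos (Or.inr rfl), plaquetteHolonomy_configReflect_right _ _ _ _ hj, re_trace_conj_inv ρ hρ]
    · rw [if_neg (by tauto), plaquetteHolonomy_configReflect_of_ne _ _ _ _ hj hk]

end TorusGeometry

/-! ## §2 Heights above the reflection plane; the positive links `P` and the in-plane links `M` -/

section TorusRP

variable {d L : ℕ} [NeZero L]

/-- The height of a site above the lattice hyperplane `x_i = c`, read in `[0, L)`. -/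
def ht (i : Fin d) (c : ZMod L) (x : Site d L) : ℕ := (x i - c).val

omit [NeZero L] in
/-- Height zero means the site lies in the reflection plane `x i = c`. -/
theorem ht_eq_zero_iff (i : Fin d) (c : ZMod L) (x : Site d L) : ht i c x = 0 ↔ x i = c := by
  rw [ht, ZMod.val_eq_zero, sub_eq_zero]

/-- `ht i c x < L`. -/
theorem ht_lt (i : Fin d) (c : ZMod L) (x : Site d L) : ht i c x < L := ZMod.val_lt _

omit [NeZero L] in
/-- Shifting in a direction `k ≠ i` does not change the height above the plane. -/
theorem ht_shift_ne (i : Fin d) (c : ZMod L) (x : Site d L) {k : Fin d} (h : k ≠ i) :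
    ht i c (x.shift k) = ht i c x := by
  simp [ht, Site.shift, Ne.symm h]

/-- Shifting in direction `i` raises the height by one (away from the wrap-around). -/
theorem ht_shift_self (i : Fin d) (c : ZMod L) (x : Site d L) (hx : ht i c x + 1 < L) :
    ht i c (x.shift i) = ht i c x + 1 := by
  haveI : Fact (1 < L) := ⟨by omega⟩
  have h1 : (x.shift i) i - c = (x i - c) + 1 := by simp [Site.shift]; abel
  unfold ht at hx ⊢
  rw [h1, ZMod.val_add, ZMod.val_one, Nat.mod_eq_of_lt hx]

/-- Height of the reflected site: `L − ht` (off the plane). -/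
theorem ht_siteReflect (i : Fin d) (c : ZMod L) (x : Site d L) (hx : ht i c x ≠ 0) :
    ht i c (siteReflect i c x) = L - ht i c x := by
  have h1 : siteReflect i c x i - c = -(x i - c) := by simp; abel
  have hx' : x i - c ≠ 0 := fun h => hx (by rw [ht, h, ZMod.val_zero])
  unfold ht
  rw [h1, ZMod.neg_val, if_neg hx']

/-- Height of the reflected-and-lowered site: `L − (ht + 1)`. -/
theorem ht_siteReflect_sub_single (i : Fin d) (c : ZMod L) (x : Site d L) (hx : ht i c x + 1 < L) :
    ht i c (siteReflect i c x - Pi.single i 1) = L - (ht i c x + 1) := by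
  haveI : Fact (1 < L) := ⟨by omega⟩
  have h1 : (siteReflect i c x - Pi.single i 1 : Site d L) i - c = -((x i - c) + 1) := by simp; abel
  have hv : ((x i - c) + 1 : ZMod L).val = ht i c x + 1 := by
    unfold ht at hx ⊢; rw [ZMod.val_add, ZMod.val_one, Nat.mod_eq_of_lt hx]
  have hne : ((x i - c) + 1 : ZMod L) ≠ 0 := fun h => by
    rw [h, ZMod.val_zero] at hv; omega
  show ((siteReflect i c x - Pi.single i 1 : Site d L) i - c).val = L - (ht i c x + 1)
  rw [h1, ZMod.neg_val, if_neg hne, hv]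

omit [NeZero L] in
/-- Sites in the reflection plane are fixed by `siteReflect i c`. -/
theorem siteReflect_eq_self_of_ht (i : Fin d) (c : ZMod L) (x : Site d L) (hx : ht i c x = 0) :
    siteReflect i c x = x := by
  rw [ht_eq_zero_iff] at hx
  ext k
  by_cases h : k = i
  · subst h; simp [hx]
  · simp [h]

/-- The POSITIVE links: links in directions `≠ i` at heights `1 … H`, and links in direction `i`
starting at heights `0 … H-1`. -/
def posEdges (i : Fin d) (c : ZMod L) (H : ℕ) : Finset (Edge d L) :=
  univ.filter fun e => (e.2 ≠ i ∧ 1 ≤ ht i c e.1 ∧ ht i c e.1 ≤ H) ∨ (e.2 = i ∧ ht i c e.1 + 1 ≤ H)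

/-- The IN-PLANE links: links in directions `≠ i` at height `0` (fixed by the reflection). -/
def planeEdges (i : Fin d) (c : ZMod L) : Finset (Edge d L) :=
  univ.filter fun e => e.2 ≠ i ∧ ht i c e.1 = 0

/-- Membership in the positive links `posEdges i c H` (heights `1..H` for directions `≠ i`, `0..H−1` for direction `i`). -/
theorem mem_posEdges {i : Fin d} {c : ZMod L} {H : ℕ} {e : Edge d L} :
    e ∈ posEdges i c H ↔ (e.2 ≠ i ∧ 1 ≤ ht i c e.1 ∧ ht i c e.1 ≤ H) ∨ (e.2 = i ∧ ht i c e.1 + 1 ≤ H) := by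
  simp [posEdges]

/-- Membership in the in-plane links `planeEdges i c` (direction `≠ i`, height `0`). -/
theorem mem_planeEdges {i : Fin d} {c : ZMod L} {e : Edge d L} :
    e ∈ planeEdges i c ↔ e.2 ≠ i ∧ ht i c e.1 = 0 := by
  simp [planeEdges]

/-- The in-plane links and the positive links are disjoint. -/
theorem disjoint_planeEdges_posEdges (i : Fin d) (c : ZMod L) (H : ℕ) :
    Disjoint (planeEdges i c) (posEdges i c H) := by
  rw [Finset.disjoint_left]
  intro e he hp
  rw [mem_planeEdges] at he
  rw [mem_posEdges] at hp
  omega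

/-- The reflection of a positive link is not positive (it lies strictly below the plane). -/
theorem edgeReflect_not_mem_posEdges {i : Fin d} {c : ZMod L} {H : ℕ} (hH : 2 * H < L) {e : Edge d L}
    (he : e ∈ posEdges i c H) : edgeReflect i c e ∉ posEdges i c H := by
  obtain ⟨x, j⟩ := e
  rw [mem_posEdges] at he
  intro hmem
  rw [mem_posEdges] at hmem
  unfold edgeReflect at hmem
  by_cases hj : j = i
  · subst hj
    simp only [if_true] at hmem
    have ht0 : ht j c x + 1 ≤ H := by
      rcases he with h | h
      · exact absurd rfl h.1
      · exact h.2
    rw [ht_siteReflect_sub_single j c x (by omega)] at hmem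
    omega
  · simp only [hj, if_false] at hmem
    have ht0 : 1 ≤ ht i c x ∧ ht i c x ≤ H := by
      rcases he with h | h
      · exact h.2
      · exact absurd h.1 hj
    rw [ht_siteReflect i c x (by omega)] at hmem
    omega

variable {G : Type*} [Group G]

/-- `Θ` fixes the in-plane links. -/
theorem configReflect_apply_of_mem_planeEdges (i : Fin d) (c : ZMod L) (U : GaugeConfig d L G)
    {e : Edge d L} (he : e ∈ planeEdges i c) : configReflect i c U e = U e := by
  obtain ⟨x, j⟩ := e
  rw [mem_planeEdges] at he
  rw [configReflect_apply_ne _ _ _ _ he.1, siteReflect_eq_self_of_ht _ _ _ he.2]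

/-- The positive coordinates of `Θ U` depend only on the coordinates of `U` off `P`. -/
theorem dependsOn_configReflect {i : Fin d} {c : ZMod L} {H : ℕ} (hH : 2 * H < L) {e : Edge d L}
    (he : e ∈ posEdges i c H ∪ ∅) :
    DependsOn (fun U : GaugeConfig d L G => configReflect i c U e) (((posEdges i c H)ᶜ : Finset (Edge d L)) : Set (Edge d L)) := by
  rw [Finset.union_empty] at he
  have hmem : edgeReflect i c e ∈ (((posEdges i c H)ᶜ : Finset (Edge d L)) : Set (Edge d L)) :=
    Finset.mem_coe.2 (Finset.mem_compl.2 (edgeReflect_not_mem_posEdges hH he))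
  intro U V hUV
  simp only [configReflect]
  rw [hUV _ hmem]

variable [MeasurableSpace G] [TopologicalSpace G] [IsTopologicalGroup G] [CompactSpace G] [BorelSpace G]

/-- **`Θ` preserves the product Haar measure** (relabelling of the links by an involution and
inversion of the links in direction `i`; Haar measure is inversion invariant). -/
theorem measurePreserving_configReflect (i : Fin d) (c : ZMod L) :
    MeasurePreserving (configReflect i c : GaugeConfig d L G → GaugeConfig d L G)
      (LatticeRP.piMeasure (haarProbability G)) (LatticeRP.piMeasure (haarProbability G)) := by
  have h1 : MeasurePreserving
      (MeasurableEquiv.arrowCongr' (edgeReflectEquiv (d := d) (L := L) i c) (MeasurableEquiv.refl G))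
      (LatticeRP.piMeasure (haarProbability G)) (LatticeRP.piMeasure (haarProbability G)) :=
    measurePreserving_arrowCongr' (fun _ => haarProbability G) (fun _ => haarProbability G)
      (edgeReflectEquiv i c) (MeasurableEquiv.refl G) fun _ => MeasurePreserving.id _
  have h2 : MeasurePreserving
      (fun (V : GaugeConfig d L G) (e : Edge d L) =>
        (if e.2 = i then (fun g : G => g⁻¹) else id) (V e))
      (LatticeRP.piMeasure (haarProbability G)) (LatticeRP.piMeasure (haarProbability G)) := by
    refine measurePreserving_pi _ _ fun e => ?_
    split_ifs
    · exact Measure.measurePreserving_inv _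
    · exact MeasurePreserving.id _
  have heq : (configReflect i c : GaugeConfig d L G → GaugeConfig d L G) =
      (fun (V : GaugeConfig d L G) (e : Edge d L) =>
        (if e.2 = i then (fun g : G => g⁻¹) else id) (V e)) ∘
      (MeasurableEquiv.arrowCongr' (edgeReflectEquiv (d := d) (L := L) i c) (MeasurableEquiv.refl G)) := by
    funext U e
    have happ : (MeasurableEquiv.arrowCongr' (edgeReflectEquiv (d := d) (L := L) i c)
        (MeasurableEquiv.refl G)) U e = U (edgeReflect i c e) := rfl
    simp only [Function.comp_apply, configReflect, happ]
    split_ifs <;> rfl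
  rw [heq]
  exact h2.comp h1

end TorusRP

end

end Summit.QuantumFields.YangMills.Cruxes.IR.RPDoubling
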